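import Mathlib
import Summits.Ventures.HodgeRepro.Tier4.Target
import Summits.Ventures.HodgeRepro.Tier4.Common.TargetBall
import Summits.Ventures.HodgeRepro.Tier4.Common.TargetCalculus
import Summits.Ventures.HodgeRepro.Tier4.Common.TargetJacobian
import Summits.Ventures.HodgeRepro.Tier4.Common.AutForms
import Summits.Ventures.HodgeRepro.Tier4.Line4.MixedTransfer
import Summits.Ventures.HodgeRepro.Tier4.Line4.Forms11
import Summits.Ventures.HodgeRepro.Tier4.Line4.MixedInvariant
import Summits.Ventures.HodgeRepro.Tier4.Line4.PullbackWedge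
import Summits.Ventures.HodgeRepro.Tier4.Line4.HoloRegularity
import Summits.Ventures.HodgeRepro.Tier4.Line4.MixedClosed
import Summits.Ventures.HodgeRepro.Tier4.Line4.ExactOnBall
import Summits.Ventures.HodgeRepro.Tier4.Line4.WirtingerChain
import Summits.Ventures.HodgeRepro.Tier4.Line3.BallChangeOfVariables
import Summits.Ventures.HodgeRepro.Tier4.Line3.DomainTransfer
import Summits.Ventures.HodgeRepro.Tier4.Line4.DomainUnfold
import Summits.Ventures.HodgeRepro.Tier4.Line4.Partition

/-!
# Tier4/Line4/QuotientTiling — the tiling summed on the domain, the invariance of `⟨ξ ∧ (dη)^{1,1}⟩`, and the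
`dχ ∧ η` term under the action (SUPPORT for L4.0′ `pair11_descends`, V2; the lemmas `StokesQuotient.lean` assembles)

Blind re-derivation cell `pub-hodge-repro`, Tier 4 (README §9–§10), seat t4-L4-p2 (prover, LINE L4, gen 0).  Tree path
`lean/Summits/Ventures/HodgeRepro/Tier4/Line4/QuotientTiling.lean`.  Imports, BY NAME, this seat's `PullbackWedge`,
`ExactOnBall`, `WirtingerChain`, `DomainUnfold`, `Partition`, t4-L4-p1's `MixedInvariant` (`jacMat`, `pull`), t4-L3-p1's
`Line3/BallChangeOfVariables` + `Line3/DomainTransfer` (tiling), typer-1's `AutForms` (`det_jacMat`).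

WHAT IS PROVED.  §1 algebra of `wedgeCoeff11` (symmetric, linear in the second argument) and the germ lemmas for
`dz` / `dzbar`; §2 `integral_ball_eq_setIntegral_tsum`: for an integrable `g` and a family `G φ` with
`|det Jac φ|² · g ∘ φ = G φ` on the fundamental domain `D`, `∫_ball g = ∫_D Σ_φ G φ`; §3 `pull_d11_eq` and
`density_invariant`: `(dη)^{1,1}` of a `Γ′`-invariant `1`-form is `Γ′`-invariant and the density `⟨ξ ∧ (dη)^{1,1}⟩` of an
invariant `ξ` against it is an invariant density (`|det Jac φ|² · f ∘ φ = f`); §4 continuity of `dz g`, `dzbar g` for `g`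
real-`C¹`, and `pull_dchi_eq`: `pull φ (dχ ∧ η)^{1,1} = (d(χ ∘ φ) ∧ η)^{1,1}` on the ball (chain rule).

Nothing here says anything about the status of the Hodge conjecture for CM abelian varieties, which is NOT proved
(HC_CM is NOT proved by anyone in this repository).
-/

set_option autoImplicit false

noncomputable section

open Matrix MeasureTheory NumberField Topology Set
open scoped ComplexConjugate

namespace Summit.Ventures.HodgeRepro.Tier4.Line4

open Summit.Ventures.HodgeRepro.Tier4 Summit.Ventures.HodgeRepro.Tier4.Line3

/-! ## 1. Algebra of `wedgeCoeff11`; the Wirtinger operators of locally equal functions -/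

/-- `⟨A ∧ B⟩ = ⟨B ∧ A⟩` (two-forms commute). -/
theorem wedgeCoeff11_comm (A B : Form11) : wedgeCoeff11 A B = wedgeCoeff11 B A := by
  simp only [wedgeCoeff11]; ring

/-- `⟨A ∧ (B − C)⟩ = ⟨A ∧ B⟩ − ⟨A ∧ C⟩` (entrywise). -/
theorem wedgeCoeff11_of_sub (A : Form11) (B C : Fin 2 → Fin 2 → ℂ) :
    wedgeCoeff11 A (Matrix.of fun k l => B k l - C k l) =
      wedgeCoeff11 A (Matrix.of B) - wedgeCoeff11 A (Matrix.of C) := by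
  simp only [wedgeCoeff11, Matrix.of_apply]; ring

/-- `⟨A ∧ (c · B)⟩ = c · ⟨A ∧ B⟩` (entrywise). -/
theorem wedgeCoeff11_of_mul (A : Form11) (c : ℂ) (B : Fin 2 → Fin 2 → ℂ) :
    wedgeCoeff11 A (Matrix.of fun k l => c * B k l) = c * wedgeCoeff11 A (Matrix.of B) := by
  simp only [wedgeCoeff11, Matrix.of_apply]; ring

/-- `⟨A ∧ Σ_i B_i⟩ = Σ_i ⟨A ∧ B_i⟩` (entrywise, finite sums). -/
theorem wedgeCoeff11_of_sum {ι : Type*} (s : Finset ι) (A : Form11) (B : ι → Fin 2 → Fin 2 → ℂ) :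
    wedgeCoeff11 A (Matrix.of fun k l => ∑ i ∈ s, B i k l) = ∑ i ∈ s, wedgeCoeff11 A (Matrix.of (B i)) := by
  simp only [wedgeCoeff11, Matrix.of_apply, Finset.mul_sum, Finset.sum_sub_distrib, Finset.sum_add_distrib,
    Finset.sum_neg_distrib]

/-- `⟨A ∧ 0⟩ = 0`. -/
theorem wedgeCoeff11_of_zero (A : Form11) : wedgeCoeff11 A (Matrix.of fun _ _ => (0 : ℂ)) = 0 := by
  simp [wedgeCoeff11]

/-- The Wirtinger operator `∂_k` only sees the germ. -/
theorem dz_congr {f g : (Fin 2 → ℂ) → ℂ} {z : Fin 2 → ℂ} (h : f =ᶠ[𝓝 z] g) (k : Fin 2) : dz k f z = dz k g z := by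
  unfold dz; rw [h.fderiv_eq]

/-- The Wirtinger operator `∂̄_k` only sees the germ. -/
theorem dzbar_congr {f g : (Fin 2 → ℂ) → ℂ} {z : Fin 2 → ℂ} (h : f =ᶠ[𝓝 z] g) (k : Fin 2) :
    dzbar k f z = dzbar k g z := by
  unfold dzbar; rw [h.fderiv_eq]

/-- `∂_k` of a constant vanishes. -/
theorem dz_const (c : ℂ) (z : Fin 2 → ℂ) (k : Fin 2) : dz k (fun _ => c) z = 0 := by
  unfold dz; simp

/-- `∂̄_k` of a constant vanishes. -/
theorem dzbar_const (c : ℂ) (z : Fin 2 → ℂ) (k : Fin 2) : dzbar k (fun _ => c) z = 0 := by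
  unfold dzbar; simp

/-- `∂_k` of a finite sum (any finite index set). -/
theorem dz_finset_sum {ι : Type*} (s : Finset ι) {F : ι → (Fin 2 → ℂ) → ℂ} {z : Fin 2 → ℂ}
    (hF : ∀ i ∈ s, DifferentiableAt ℝ (F i) z) (k : Fin 2) :
    dz k (fun w => ∑ i ∈ s, F i w) z = ∑ i ∈ s, dz k (F i) z := by
  unfold dz
  rw [fderiv_fun_sum hF]
  simp only [FunLike.coe_sum, Finset.sum_apply, Finset.mul_sum]
  rw [← Finset.sum_sub_distrib, Finset.mul_sum]

/-- `∂̄_k` of a finite sum (any finite index set). -/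
theorem dzbar_finset_sum {ι : Type*} (s : Finset ι) {F : ι → (Fin 2 → ℂ) → ℂ} {z : Fin 2 → ℂ}
    (hF : ∀ i ∈ s, DifferentiableAt ℝ (F i) z) (k : Fin 2) :
    dzbar k (fun w => ∑ i ∈ s, F i w) z = ∑ i ∈ s, dzbar k (F i) z := by
  unfold dzbar
  rw [fderiv_fun_sum hF]
  simp only [FunLike.coe_sum, Finset.sum_apply, Finset.mul_sum]
  rw [← Finset.sum_add_distrib, Finset.mul_sum]

/-! ## 2. The tiling, pulled back to the domain with a general family of pulled-back integrands -/

section Tiling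

variable {E : Type*} [Field E] [NumberField E] {c : E ≃+* E} {H : Matrix (Fin 3) (Fin 3) E} {τ₀ : E →+* ℂ}
  {C : Matrix (Fin 3) (Fin 3) ℂ} {Γ' : Set (Matrix (Fin 3) (Fin 3) E)}

/-- **The tiling, summed on the domain**: for an integrable `g` and a family `G φ` with
`|det Jac φ|² · g ∘ φ = G φ` on `D`, `∫_ball g = ∫_D Σ_φ G φ`. -/
theorem integral_ball_eq_setIntegral_tsum (hΓ : IsCongruenceSubgroup c H Γ') (hτ : ∀ x, τ₀ (c x) = conj (τ₀ x))
    (hC : IsSylvester (H.map τ₀) C) {D : Set (Fin 2 → ℂ)} (hD : IsFundamentalDomainFor (ballActions τ₀ C Γ') D)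
    {g : (Fin 2 → ℂ) → ℂ} (hg : Integrable g) {G : ballActions τ₀ C Γ' → (Fin 2 → ℂ) → ℂ}
    (hG : ∀ φ : ballActions τ₀ C Γ', ∀ z ∈ D, (Complex.normSq (jacDetMap φ.1 z) : ℂ) * g (φ.1 z) = G φ z) :
    ∫ z in ball, g z = ∫ z in D, ∑' φ : ballActions τ₀ C Γ', G φ z := by
  haveI : Countable (ballActions τ₀ C Γ') := countable_ballActions
  have hDb : D ⊆ ball := hD.2.1
  have hDm : MeasurableSet D := hD.1
  have hNeq : ∀ φ : ballActions τ₀ C Γ', ∀ z ∈ D,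
      Complex.normSq (jacDetMap φ.1 z) * ‖g (φ.1 z)‖ = ‖G φ z‖ := by
    intro φ z hz
    have h := congrArg (fun w : ℂ => ‖w‖) (hG φ z hz)
    simp only [norm_mul, Complex.norm_real, Real.norm_eq_abs, abs_of_nonneg (Complex.normSq_nonneg _)] at h
    exact h
  have hsum : Summable fun φ : ballActions τ₀ C Γ' => ∫ z in D, ‖G φ z‖ := by
    refine (hasSum_setIntegral_domain_real hΓ hτ hC hD hg.norm.integrableOn).summable.congr fun φ => ?_
    exact setIntegral_congr_fun hDm fun z hz => hNeq φ z hz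
  have hFint : ∀ φ : ballActions τ₀ C Γ', IntegrableOn (G φ) D := by
    intro φ
    obtain ⟨M, hM, hφ⟩ := exists_unitaryJ_of_mem_ballActions hΓ hτ hC φ.2
    have h1 : IntegrableOn g (φ.1 '' D) := hg.integrableOn
    rw [hφ, integrableOn_image_actM_iff hM hDm hDb] at h1
    refine h1.congr_fun (fun z hz => ?_) hDm
    have h2 := hG φ z hz
    rw [hφ] at h2
    exact h2
  rw [integral_ball_eq_tsum_domain hΓ hτ hC hD hg.integrableOn,
    tsum_congr fun φ => setIntegral_congr_fun hDm fun z hz => hG φ z hz]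
  exact integral_tsum_of_summable_integral_norm (μ := volume.restrict D) hFint hsum

end Tiling

/-! ## 3. The density `⟨ξ ∧ (dη)^{1,1}⟩` of an invariant cocycle against an invariant `1`-form is invariant -/

section Invariance

variable {E : Type*} [Field E] {c : E ≃+* E} {H : Matrix (Fin 3) (Fin 3) E} {τ₀ : E →+* ℂ}
  {C : Matrix (Fin 3) (Fin 3) ℂ} {Γ' : Set (Matrix (Fin 3) (Fin 3) E)}

/-- Every map of `ballActions` is ℂ-differentiable at every point of the ball. -/
theorem differentiableAt_of_mem_ballActions (hΓ : IsCongruenceSubgroup c H Γ') (hτ : ∀ x, τ₀ (c x) = conj (τ₀ x))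
    (hC : IsSylvester (H.map τ₀) C) {φ : (Fin 2 → ℂ) → (Fin 2 → ℂ)} (hφ : φ ∈ ballActions τ₀ C Γ') {z : Fin 2 → ℂ}
    (hz : z ∈ ball) : DifferentiableAt ℂ φ z := by
  obtain ⟨M, hM, rfl⟩ := exists_unitaryJ_of_mem_ballActions hΓ hτ hC hφ
  exact (differentiableOn_actM hM).differentiableAt (isOpen_ball.mem_nhds hz)

/-- The entries of the Jacobian matrix are the partials. -/
theorem jacMat_apply_eq_pd {φ : (Fin 2 → ℂ) → (Fin 2 → ℂ)} {z : Fin 2 → ℂ} (hφ : DifferentiableAt ℂ φ z) (m k : Fin 2) :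
    jacMat φ z m k = pd k (fun w => φ w m) z := by
  rw [jacMat_eq_of_differentiableAt hφ]
  rfl

/-- `det J · conj (det J) = |det Jac φ|²`. -/
theorem det_jacMat_mul_conj {φ : (Fin 2 → ℂ) → (Fin 2 → ℂ)} {z : Fin 2 → ℂ} (hφ : DifferentiableAt ℂ φ z) :
    (jacMat φ z).det * conj (jacMat φ z).det = (Complex.normSq (jacDetMap φ z) : ℂ) := by
  rw [jacMat_eq_of_differentiableAt hφ, det_jacMat, Complex.mul_conj]

/-- **Naturality of `(dη)^{1,1}` under the action** (for an invariant `1`-form): `pull φ (dη)^{1,1} = (dη)^{1,1}` on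
the ball when `Jᵀ η¹ ∘ φ = η¹` and `J̄ᵀ η² ∘ φ = η²` on the ball. -/
theorem pull_d11_eq (hΓ : IsCongruenceSubgroup c H Γ') (hτ : ∀ x, τ₀ (c x) = conj (τ₀ x))
    (hC : IsSylvester (H.map τ₀) C) {φ : (Fin 2 → ℂ) → (Fin 2 → ℂ)} (hφ : φ ∈ ballActions τ₀ C Γ')
    {η₁ η₂ : (Fin 2 → ℂ) → (Fin 2 → ℂ)} (hη₁ : ∀ k, ContDiffOn ℝ 1 (fun z => η₁ z k) ball)
    (hη₂ : ∀ k, ContDiffOn ℝ 1 (fun z => η₂ z k) ball)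
    (hηi : ∀ z ∈ ball, (jacMat φ z)ᵀ *ᵥ η₁ (φ z) = η₁ z ∧ ((jacMat φ z).map (starRingEnd ℂ))ᵀ *ᵥ η₂ (φ z) = η₂ z)
    {z : Fin 2 → ℂ} (hz : z ∈ ball) :
    pull φ (fun w => Matrix.of fun k l => dz k (fun w' => η₂ w' l) w - dzbar l (fun w' => η₁ w' k) w) z =
      Matrix.of fun k l => dz k (fun w' => η₂ w' l) z - dzbar l (fun w' => η₁ w' k) z := by
  have hφd : DifferentiableOn ℂ φ ball := by
    obtain ⟨M, hM, rfl⟩ := exists_unitaryJ_of_mem_ballActions hΓ hτ hC hφ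
    exact differentiableOn_actM hM
  have hφz : DifferentiableAt ℂ φ z := differentiableAt_of_mem_ballActions hΓ hτ hC hφ hz
  have hφm : ∀ m, DifferentiableOn ℂ (fun w => φ w m) ball := fun m => (differentiableOn_pi.mp hφd) m
  have hφzb : φ z ∈ ball := mem_ball_of_mem_ballActions hΓ hτ hC hφ hz
  have hd1 : ∀ m, DifferentiableAt ℝ (fun w => η₁ w m) (φ z) := fun m =>
    ((hη₁ m).differentiableOn one_ne_zero).differentiableAt (isOpen_ball.mem_nhds hφzb)
  have hd2 : ∀ n, DifferentiableAt ℝ (fun w => η₂ w n) (φ z) := fun n =>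
    ((hη₂ n).differentiableOn one_ne_zero).differentiableAt (isOpen_ball.mem_nhds hφzb)
  -- the pulled-back coefficient functions agree with `η` near `z`
  have e1 : ∀ k, (fun w => ∑ m, pd k (fun w' => φ w' m) w * η₁ (φ w) m) =ᶠ[𝓝 z] fun w => η₁ w k := by
    intro k
    filter_upwards [isOpen_ball.mem_nhds hz] with w hw
    have := congrFun (hηi w hw).1 k
    rw [← this]
    simp only [Matrix.mulVec, dotProduct, Matrix.transpose_apply]
    refine Finset.sum_congr rfl fun m _ => ?_
    rw [jacMat_apply_eq_pd (differentiableAt_of_mem_ballActions hΓ hτ hC hφ hw)]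
  have e2 : ∀ l, (fun w => ∑ n, conj (pd l (fun w' => φ w' n) w) * η₂ (φ w) n) =ᶠ[𝓝 z] fun w => η₂ w l := by
    intro l
    filter_upwards [isOpen_ball.mem_nhds hz] with w hw
    have := congrFun (hηi w hw).2 l
    rw [← this]
    simp only [Matrix.mulVec, dotProduct, Matrix.transpose_apply, Matrix.map_apply]
    refine Finset.sum_congr rfl fun n _ => ?_
    rw [jacMat_apply_eq_pd (differentiableAt_of_mem_ballActions hΓ hτ hC hφ hw)]
  ext k l
  simp only [pull, Matrix.mul_apply, Matrix.transpose_apply, Matrix.map_apply, Matrix.of_apply]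
  rw [← dz_congr (e2 l) k, ← dzbar_congr (e1 k) l, d11_pull1 isOpen_ball hφm hz hd1 hd2 k l]
  simp only [Finset.sum_mul]
  rw [Finset.sum_comm]
  refine Finset.sum_congr rfl fun m _ => Finset.sum_congr rfl fun n _ => ?_
  rw [jacMat_apply_eq_pd hφz, jacMat_apply_eq_pd hφz]
  ring

/-- **The density `⟨ξ ∧ (dη)^{1,1}⟩` is `Γ′`-invariant** for an invariant `ξ` and an invariant `1`-form `η`. -/
theorem density_invariant (hΓ : IsCongruenceSubgroup c H Γ') (hτ : ∀ x, τ₀ (c x) = conj (τ₀ x))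
    (hC : IsSylvester (H.map τ₀) C) {ξ : (Fin 2 → ℂ) → Form11}
    (hξi : ∀ φ ∈ ballActions τ₀ C Γ', ∀ z ∈ ball, pull φ ξ z = ξ z)
    {η₁ η₂ : (Fin 2 → ℂ) → (Fin 2 → ℂ)} (hη₁ : ∀ k, ContDiffOn ℝ 1 (fun z => η₁ z k) ball)
    (hη₂ : ∀ k, ContDiffOn ℝ 1 (fun z => η₂ z k) ball)
    (hηi : ∀ φ ∈ ballActions τ₀ C Γ', ∀ z ∈ ball,
      (jacMat φ z)ᵀ *ᵥ η₁ (φ z) = η₁ z ∧ ((jacMat φ z).map (starRingEnd ℂ))ᵀ *ᵥ η₂ (φ z) = η₂ z)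
    {φ : (Fin 2 → ℂ) → (Fin 2 → ℂ)} (hφ : φ ∈ ballActions τ₀ C Γ') {z : Fin 2 → ℂ} (hz : z ∈ ball) :
    (Complex.normSq (jacDetMap φ z) : ℂ) *
      wedgeCoeff11 (ξ (φ z)) (Matrix.of fun k l => dz k (fun w => η₂ w l) (φ z) - dzbar l (fun w => η₁ w k) (φ z)) =
    wedgeCoeff11 (ξ z) (Matrix.of fun k l => dz k (fun w => η₂ w l) z - dzbar l (fun w => η₁ w k) z) := by
  have hφz : DifferentiableAt ℂ φ z := differentiableAt_of_mem_ballActions hΓ hτ hC hφ hz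
  have h := wedgeCoeff11_pull φ ξ
    (fun w => Matrix.of fun k l => dz k (fun w' => η₂ w' l) w - dzbar l (fun w' => η₁ w' k) w) z
  rw [hξi φ hφ z hz, pull_d11_eq hΓ hτ hC hφ hη₁ hη₂ (hηi φ hφ) hz, det_jacMat_mul_conj hφz] at h
  exact h.symm

end Invariance

/-! ## 4. Continuity of the Wirtinger derivatives of a `C²` function; the `dχ ∧ η` term under the action -/

section Cutoff

variable {E : Type*} [Field E] {c : E ≃+* E} {H : Matrix (Fin 3) (Fin 3) E} {τ₀ : E →+* ℂ}
  {C : Matrix (Fin 3) (Fin 3) ℂ} {Γ' : Set (Matrix (Fin 3) (Fin 3) E)}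

/-- `∂_k g` is continuous on the ball for `g` real-`C¹` on the ball. -/
theorem continuousOn_dz {g : (Fin 2 → ℂ) → ℂ} (hg : ContDiffOn ℝ 1 g ball) (k : Fin 2) :
    ContinuousOn (dz k g) ball := by
  have hc : ContinuousOn (fderiv ℝ g) ball := hg.continuousOn_fderiv_of_isOpen isOpen_ball le_rfl
  show ContinuousOn (fun z => (1 / 2 : ℂ) * (fderiv ℝ g z (Pi.single k 1) - Complex.I * fderiv ℝ g z (Pi.single k Complex.I))) ball
  exact continuousOn_const.mul ((hc.clm_apply continuousOn_const).sub
    (continuousOn_const.mul (hc.clm_apply continuousOn_const)))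

/-- `∂̄_k g` is continuous on the ball for `g` real-`C¹` on the ball. -/
theorem continuousOn_dzbar {g : (Fin 2 → ℂ) → ℂ} (hg : ContDiffOn ℝ 1 g ball) (k : Fin 2) :
    ContinuousOn (dzbar k g) ball := by
  have hc : ContinuousOn (fderiv ℝ g) ball := hg.continuousOn_fderiv_of_isOpen isOpen_ball le_rfl
  show ContinuousOn (fun z => (1 / 2 : ℂ) * (fderiv ℝ g z (Pi.single k 1) + Complex.I * fderiv ℝ g z (Pi.single k Complex.I))) ball
  exact continuousOn_const.mul ((hc.clm_apply continuousOn_const).add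
    (continuousOn_const.mul (hc.clm_apply continuousOn_const)))

/-- **The `dχ ∧ η` term under the action**: for `φ ∈ ballActions` and `η` invariant,
`pull φ (dχ ∧ η)^{1,1} = (d(χ ∘ φ) ∧ η)^{1,1}` on the ball. -/
theorem pull_dchi_eq (hΓ : IsCongruenceSubgroup c H Γ') (hτ : ∀ x, τ₀ (c x) = conj (τ₀ x))
    (hC : IsSylvester (H.map τ₀) C) {φ : (Fin 2 → ℂ) → (Fin 2 → ℂ)} (hφ : φ ∈ ballActions τ₀ C Γ')
    {χc : (Fin 2 → ℂ) → ℂ} (hχ : ∀ z ∈ ball, DifferentiableAt ℝ χc z) {η₁ η₂ : (Fin 2 → ℂ) → (Fin 2 → ℂ)}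
    (hηi : ∀ z ∈ ball, (jacMat φ z)ᵀ *ᵥ η₁ (φ z) = η₁ z ∧ ((jacMat φ z).map (starRingEnd ℂ))ᵀ *ᵥ η₂ (φ z) = η₂ z)
    {z : Fin 2 → ℂ} (hz : z ∈ ball) :
    pull φ (fun w => Matrix.of fun k l => dz k χc w * η₂ w l - dzbar l χc w * η₁ w k) z =
      Matrix.of fun k l => dz k (fun w => χc (φ w)) z * η₂ z l - dzbar l (fun w => χc (φ w)) z * η₁ z k := by
  have hφz : DifferentiableAt ℂ φ z := differentiableAt_of_mem_ballActions hΓ hτ hC hφ hz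
  have hφzb : φ z ∈ ball := mem_ball_of_mem_ballActions hΓ hτ hC hφ hz
  have h1 : ∀ k, η₁ z k = ∑ m, pd k (fun w => φ w m) z * η₁ (φ z) m := by
    intro k
    have := congrFun (hηi z hz).1 k
    rw [← this]
    simp only [Matrix.mulVec, dotProduct, Matrix.transpose_apply]
    exact Finset.sum_congr rfl fun m _ => by rw [jacMat_apply_eq_pd hφz]
  have h2 : ∀ l, η₂ z l = ∑ n, conj (pd l (fun w => φ w n) z) * η₂ (φ z) n := by
    intro l
    have := congrFun (hηi z hz).2 l
    rw [← this]
    simp only [Matrix.mulVec, dotProduct, Matrix.transpose_apply, Matrix.map_apply]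
    exact Finset.sum_congr rfl fun n _ => by rw [jacMat_apply_eq_pd hφz]
  ext k l
  simp only [pull, Matrix.mul_apply, Matrix.transpose_apply, Matrix.map_apply, Matrix.of_apply]
  rw [dz_comp (hχ _ hφzb) hφz, dzbar_comp (hχ _ hφzb) hφz, h1 k, h2 l]
  simp only [Fin.sum_univ_two, jacMat_apply_eq_pd hφz]
  ring

end Cutoff


end Summit.Ventures.HodgeRepro.Tier4.Line4

end
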